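import Summits.CriticalPhenomena.CardyFormulaZ2.Theses.CardyQContinuation
import Literature.Probability.Percolation.BoxCrossingProofs
import Literature.Probability.Percolation.TriApproxDomainProofs

/-!
# Crux `IsingJetsConformal`, stub `stub_isingCrossingConformal_discreteArc_near_pt_of_close`:
# close vertices of consecutive discrete arcs lie near the common marked point
# (route `CardyQContinuation`, item stmt-CriticalPhenomena-5560)

The bridge from the tree's discretisation of a conformal rectangle `R = (Ω; p₀, p₁, p₂, p₃)`
(`meshDomain Ω δ`, discrete boundary `meshBoundary Ω δ`, discrete arcs `discreteArc Ω δ (R.arc i)`,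
`DomainDiscretisation.lean`) to Chelkak–Smirnov's discrete quadrilaterals cuts the discrete
boundary into four stretches at "colour-change" vertices, where a vertex of the discrete arc of
`arc i` is equal or adjacent to a vertex of the discrete arc of `arc (i + 1)`. This file localises
them: for every `r > 0`, for all small `δ > 0` (uniformly in `i` and in the vertices), two vertices
`x ∈ (arc i)_δ`, `y ∈ (arc (i+1))_δ` whose mesh points are within `2δ` of each other have `δx`
within `r` of the common marked point `pt (i + 1)` (indices in `Fin 4`, so `arc 3` ends at `pt 0`).

Proof. A vertex of the discrete arc of `A` is within `δ` of `A`
(`Literature.Probability.Percolation.infDist_le_of_mem_discreteArc`), so there are `p ∈ arc i`,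
`q ∈ arc (i + 1)` with `dist (δx) p ≤ δ`, `dist (δy) q ≤ δ` (compact arcs), whence
`dist p q ≤ 4δ`. Consecutive arcs meet only at the marked point between them, so by compactness
points of `arc i` and `arc (i + 1)` that are `σ`-close are `r/2`-close to `pt (i + 1)`
(`MarkedDomain.exists_forall_dist_pt_lt`, `TriApproxDomainProofs.lean`); for `4δ < σ` and
`3δ < r/2` this gives `dist (δx) (pt (i+1)) ≤ 3δ + dist q (pt (i+1)) ≤ r`. Uniformity in
`i : Fin 4` is `Filter.eventually_all`.

References: S. Smirnov, C. R. Acad. Sci. Paris 333 (2001), §2 (discrete arcs);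
D. Chelkak, S. Smirnov, Invent. Math. 189 (2012), §1.2; B. Bollobás, O. Riordan, *Percolation*
(2006), Ch. 7 p. 191 (the closest arc can only switch near a corner).
-/

namespace Summit.CriticalPhenomena.CardyFormulaZ2.Theorems.CardyQContinuation

open Set Metric Filter
open scoped Topology
open Literature.Probability.LatticeModels Literature.Probability.Percolation
open Literature.Probability.RandomPlanarGeometry

noncomputable section

namespace DiscreteArcNearPt

/-- **Fixed-index form.** For a conformal rectangle `R`, `r > 0` and `i : Fin 4`, for all small
`δ > 0`: vertices `x ∈ (arc i)_δ`, `y ∈ (arc (i + 1))_δ` with `dist (δx) (δy) ≤ 2δ` satisfy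
`dist (δx) (pt (i + 1)) ≤ r`. Nearest arc points `p`, `q` of `δx`, `δy` are `4δ`-close, hence
(`MarkedDomain.exists_forall_dist_pt_lt`) `q` is `r/2`-close to `pt (i + 1)`. [folklore] -/
theorem eventually_dist_meshPoint_pt_succ_le (R : ConformalRectangle) {r : ℝ} (hr : 0 < r)
    (i : Fin 4) :
    ∀ᶠ δ in 𝓝[>] (0 : ℝ), ∀ x y : Site 2,
      x ∈ discreteArc R.carrier δ (R.arc i) → y ∈ discreteArc R.carrier δ (R.arc (i + 1)) →
      dist (meshPoint δ x) (meshPoint δ y) ≤ 2 * δ →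
      dist (meshPoint δ x) (R.pt (i + 1)) ≤ r := by
  obtain ⟨σ, hσ, hσP⟩ := R.exists_forall_dist_pt_lt (i + 1) (half_pos hr)
  rw [add_sub_cancel_right] at hσP
  filter_upwards [Ioo_mem_nhdsGT (show (0 : ℝ) < min (σ / 8) (r / 6) by positivity)]
    with δ hδ x y hx hy hxy
  obtain ⟨hδ0, hδlt⟩ := hδ
  have hδσ : δ < σ / 8 := hδlt.trans_le (min_le_left _ _)
  have hδr : δ < r / 6 := hδlt.trans_le (min_le_right _ _)
  have hxA := infDist_le_of_mem_discreteArc R.isOpen hx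
  have hyA := infDist_le_of_mem_discreteArc R.isOpen hy
  rw [abs_of_pos hδ0] at hxA hyA
  obtain ⟨p, hp, hpd⟩ :=
    (R.isCompact_arc i).exists_infDist_eq_dist ⟨_, R.pt_mem_arc_self i⟩ (meshPoint δ x)
  obtain ⟨q, hq, hqd⟩ :=
    (R.isCompact_arc (i + 1)).exists_infDist_eq_dist ⟨_, R.pt_mem_arc_self (i + 1)⟩
      (meshPoint δ y)
  rw [hpd] at hxA
  rw [hqd] at hyA
  have hpq : dist p q < σ := by
    have t := dist_triangle4 p (meshPoint δ x) (meshPoint δ y) q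
    linarith [dist_comm p (meshPoint δ x)]
  have hqpt : dist q (R.pt (i + 1)) < r / 2 := hσP p hp q hq hpq
  have t := dist_triangle4 (meshPoint δ x) (meshPoint δ y) q (R.pt (i + 1))
  linarith

end DiscreteArcNearPt

open DiscreteArcNearPt

/-- **Stub `stub_isingCrossingConformal_discreteArc_near_pt_of_close`** of the skeleton of the
crux `IsingJetsConformal` (stmt-CriticalPhenomena-5560): for a conformal rectangle `R` and
`r > 0`, for all small `δ > 0`, uniformly in `i : Fin 4`, two vertices of the consecutive discrete
arcs `(arc i)_δ`, `(arc (i + 1))_δ` whose mesh points are within `2δ` of each other (e.g. equal or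
lattice neighbours) lie within `r` of the common marked point `pt (i + 1)` (fixed-index form
`eventually_dist_meshPoint_pt_succ_le` and `Filter.eventually_all` over `Fin 4`). [folklore] -/
theorem stub_isingCrossingConformal_discreteArc_near_pt_of_close : (∀ (R : Literature.Probability.RandomPlanarGeometry.ConformalRectangle) (r : ℝ), 0 < r → ∀ᶠ δ in nhdsWithin (0:ℝ) (Set.Ioi 0), ∀ (i : Fin 4) (x y : Literature.Probability.LatticeModels.Site 2), x ∈ Literature.Probability.LatticeModels.discreteArc R.carrier δ (R.arc i) → y ∈ Literature.Probability.LatticeModels.discreteArc R.carrier δ (R.arc (i + 1)) → dist (Literature.Probability.LatticeModels.meshPoint δ x) (Literature.Probability.LatticeModels.meshPoint δ y) ≤ 2 * δ → dist (Literature.Probability.LatticeModels.meshPoint δ x) (R.pt (i + 1)) ≤ r) := by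
  intro R r hr
  exact eventually_all.2 fun i => eventually_dist_meshPoint_pt_succ_le R hr i

end

end Summit.CriticalPhenomena.CardyFormulaZ2.Theorems.CardyQContinuation
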